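/-
Copyright: the b2b-balaban cell (near-miss cell 7), T⁴-continuum fan-out; row NE7b crux team, seat
t4-ne7b-formalise-leaf-05 gen 25 (IR-41-5 «S12-W», leaf-05 part: the J-layer zone-skeleton twins, file J2 «MEMBER-Z»;
S12-W work list §A row J of leaf-03 gen 21).  Released under the licence of the surrounding project.
-/
import Summits.QuantumFields.BalabanUV.T4Continuum.Support.HistoryJoinsPlacedMember
import Summits.QuantumFields.BalabanUV.T4Continuum.Support.HistoryJoinsPlacedContactZ

/-!
# T3b, file 4 «MEMBER» over the ZONE SKELETON of a realisation (J2, the `RealisesZ` twin of file 4's realised half)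

Summits-side support leaf of the T⁴-continuum cell (rung (B)+1 on a FINITE torus only; NOT infinite volume, NOT the
mass gap, NOT the Clay statement; NOT a proof of the spine estimate NE7b, which is the cell's OWN estimate, NOT PRINTED
and NOT PROVED).  Row NE7b, owner road R-P1, repair route R-41-a (owner g41): the END ∕ headline re-plug over the
memory-agnostic carriers (INTERFACE REQUEST NE7b IR-41-5 «S12-W», «leaf-02∕05 on their own modules»; S12-W work list
§A row J; §C: W2∕W3 key on the name `step_le_lastStep_of_realises·`).  [folklore] COMPOSITION BY NAME over the
lineage's OWN carriers; nothing is quoted from print, nothing printed is asserted, no `[cite:]` tag, no `Prop`-valued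
fact minted, no definition.

WHY ∕ WHAT.  File 4 (`HistoryJoinsPlacedMember`, this lineage gen 4) reads a REALISED member (`Realises L s R g Z`) into
a counted placement of its sorted twin.  Of the realisation it spends only the physical births' dating and facts and
file 3a's cluster predicate — all three available over leaf-07 gen 17's clock-free zone skeleton `HistoryZones.RealisesZ
L s g Z` (IR-41-6) by file J1 (`HistoryJoinsPlacedContactZ`).  This file re-runs file 4's realised half over `RealisesZ`:
§1 **`step_le_lastStep_of_realisesZ`**, `facts_of_realisesZ`; §2 `allJoins_physTop_sortRZ`; §3 **`exists_mem_S_sortRZ`** —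
statements = the landed ones with `Realises L sP Rw g Z ↦ RealisesZ L sP g Z` (the sizes `Rw` disappear), proofs = the
landed scripts with the J1 ∕ `…Z` suppliers swapped in and the idle pendency ∕ readiness pattern slots removed.  File 4's
§1 structure lemmas (`exists_core_of_mem_crootsP`, `fst_mem_births_toGen`) read no realisation and are used as landed.
§4 sanity: the LANDED `exists_mem_S_sortR` statement and its print-exact twin are corollaries through the two bridges.

HONEST SCOPE.  Composition over OUR carriers.  `RealisesZ`∕`HeadOldest`∕`RenewDated` (weakenings ∕ parts of H3's
reading) and `hdis` (R-OWNER-23-6) are HYPOTHESES; nothing of H3∕(B)∕BetaPertH is discharged; `hmult` NOT retired; by-name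
class of every `WALL-NE7b-P1.md` §2 binder UNCHANGED; NE7b NOT proved.  HONEST DEPENDENCY (cell): continuum YM on T⁴ ⇐
BetaPertH ∧ nine spine estimates (0/9 proved); BetaPertH ⇐ (D1) ∧ (D4) ∧ CAP+tail; G-an2-4 gates asym, D1 and NE2/3/4.
This file changes none of it.
-/

open Finset
open Literature.MathematicalPhysics.QuantumFieldTheory.Balaban1983to89
open Literature.MathematicalPhysics.QuantumFieldTheory.Balaban1983to89.B13ScaleTransfer (Pt FaceConnected)
open Literature.MathematicalPhysics.QuantumFieldTheory.Balaban1983to89.B16SProfile (DropCtl)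
open Literature.MathematicalPhysics.QuantumFieldTheory.Balaban1983to89.TreeLength (treeLen)
open T4PersistenceDictionary T4PartnerMultiplicity T4BranchingRecordsGas
open Summit.QuantumFields.BalabanUV.T4Continuum.PlacementSkeleton
open Summit.QuantumFields.BalabanUV.T4Continuum.ZoneTorus
open Summit.QuantumFields.BalabanUV.T4Continuum.ZoneSkeleton
open Summit.QuantumFields.BalabanUV.T4Continuum.HistoryZones
open Summit.QuantumFields.BalabanUV.T4Continuum.HistoryZoneEvolve
open Summit.QuantumFields.BalabanUV.T4Continuum.HistoryZoneMassPieces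
open Summit.QuantumFields.BalabanUV.T4Continuum.HistoryZoneMassJoins
open Summit.QuantumFields.BalabanUV.T4Continuum.HistoryAdmissible
open Summit.QuantumFields.BalabanUV.T4Continuum.HistoryRealise
open Summit.QuantumFields.BalabanUV.T4Continuum.HistoryGen
open Summit.QuantumFields.BalabanUV.T4Continuum.HistoryJoins
open Summit.QuantumFields.BalabanUV.T4Continuum.HistoryJoinsAdm
open Summit.QuantumFields.BalabanUV.T4Continuum.HistoryJoinsTag
open Summit.QuantumFields.BalabanUV.T4Continuum.HistoryJoinsRearrange
open Summit.QuantumFields.BalabanUV.T4Continuum.HistoryJoinsClusterContact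
open Summit.QuantumFields.BalabanUV.T4Continuum.HistoryJoinsPlacedTagged
open Summit.QuantumFields.BalabanUV.T4Continuum.HistoryRegionTemplates
open Summit.QuantumFields.BalabanUV.T4Continuum.HistoryJoinsTemplates
open Summit.QuantumFields.BalabanUV.T4Continuum.HistoryJoinsPlacedZone
open Summit.QuantumFields.BalabanUV.T4Continuum.HistoryJoinsPlacedZoneRead
open Summit.QuantumFields.BalabanUV.T4Continuum.HistoryJoinsPlacedValue
open Summit.QuantumFields.BalabanUV.T4Continuum.HistoryJoinsPlacedPhys
open Summit.QuantumFields.BalabanUV.T4Continuum.HistoryJoinsPlacedContact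
open Summit.QuantumFields.BalabanUV.T4Continuum.HistorySiblingEntropyBridge

namespace Summit.QuantumFields.BalabanUV.T4Continuum.HistoryJoinsPlacedMember

noncomputable section

open scoped Classical

/-! ## §1 Births of zone-skeleton realised members -/

section RealisedFactsZ

variable {d L : ℕ} {sP : ℕ → ℕ}

/-- **EVERY PHYSICAL BIRTH OF A ZONE-SKELETON REALISED MEMBER IS DATED NO LATER THAN ITS LAST STEP.** [folklore] -/
theorem step_le_lastStep_of_realisesZ : ∀ (m : PGen (Pt d × Finset (Pt d))) (Z : Finset (Pt d)),
    RealisesZ L sP m Z → ∀ bz ∈ m.pbirths, bz.1.step ≤ m.lastStep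
  | PGen.birth j cls zZ, Z, _, bz, hbz => by
      simp only [PGen.pbirths_birth, Multiset.mem_singleton] at hbz
      subst hbz; exact le_rfl
  | PGen.renew G h, Z, hR, bz, hbz => by
      obtain ⟨ZG, hG, hlt, -⟩ := hR
      have := step_le_lastStep_of_realisesZ G ZG hG bz (by simpa using hbz)
      simp only [PGen.lastStep]; omega
  | PGen.join A B s, Z, hR, bz, hbz => by
      obtain ⟨ZA, ZB, hA, hB, hAt, hBt, -, -⟩ := hR
      rw [PGen.pbirths_join, Multiset.mem_add] at hbz
      rcases hbz with h | h
      · exact (step_le_lastStep_of_realisesZ A ZA hA bz h).trans hAt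
      · exact (step_le_lastStep_of_realisesZ B ZB hB bz h).trans hBt

/-- **THE BIRTH FACTS OF A ZONE-SKELETON REALISED MEMBER** (anchor ∈ region, face-connected, `treeLen ≤ fat`) on its
physical births (leaf-07 gen 17's `births_facts_of_corrZ` on the payload-tagged tree). [folklore] -/
theorem facts_of_realisesZ {m : PGen (Pt d × Finset (Pt d))} {Z : Finset (Pt d)} (hR : RealisesZ L sP m Z)
    {bz : PEv × (Pt d × Finset (Pt d))} (hbz : bz ∈ m.pbirths) :
    bz.2.1 ∈ bz.2.2 ∧ FaceConnected bz.2.2 ∧ treeLen bz.2.2 ≤ (bz.1.fat : ℝ) := by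
  have hb : bz ∈ births (toGenL m) := by rw [births_toGenL]; exact Multiset.mem_toFinset.2 hbz
  obtain ⟨-, h1, h2, h3⟩ := births_facts_of_corrZ m (toGenL m) Z (corr_toGenL m) hR bz hb
  exact ⟨h1, h2, h3⟩

end RealisedFactsZ

/-! ## §2 The twin's placement satisfies `PhysTop` at every join (zone-skeleton reading) -/

section MemberZ

variable {α π : Type*} [DecidableEq α] [DecidableEq π] {d n L K D M : ℕ} (P : Pedigree α π)
  (cellP : π → Pt d × Finset (Pt d)) (hN : 0 < n * L ^ K) (hM : 1 ≤ M) (c₀ : TCell d (n * L ^ K) × Template d M)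
  {R' : Type*} [LinearOrder R'] (ρ : (Addr D → TCell d (n * L ^ K) × Template d M) → R')
  (hL : 3 ≤ L) (hn : 0 < n) {sP : ℕ → ℕ} (hs : ∀ t, sP (t + 1) ≤ sP t) (hdrop : ∀ m, DropCtl sP m)
include hL hn hs hdrop

/-- **THE SORTED TWIN's PLACEMENT SATISFIES THE ORDER-FREE DATUM `PhysTop` AT EVERY JOIN** (hence `AllJoins`), for a
member realised in the ZONE-SKELETON sense. [folklore] -/
theorem allJoins_physTop_sortRZ (hH : ∀ c, P.HeadOldest c) (hS : P.RenewDated) (c : α) {Z : Finset (Pt d)}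
    (hR : RealisesZ L sP (P.toPGen cellP c) Z) (hKg : (P.toPGen cellP c).lastStep ≤ K) (hKc : P.step c ≤ K)
    (hD : ∀ a ∈ baddr (P.sortR.gen c), a.length ≤ D)
    (hMf : ∀ bz ∈ (P.toPGen cellP c).pbirths, tcap d bz.1.fat ≤ M)
    (hdis : ((P.toPGen cellP c).pbirths.map fun bz => (bz.1, valP n L K hN (levelOf sP K) M hM bz.1 bz.2)).Nodup) :
    AllJoins c₀ PEv.step (PhysTop c₀ PEv.step (zoneP n L K (levelOf sP K) 32 c₀)) (P.sortR.gen c)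
      (PGen.placed (D := D) c₀ (valP n L K hN (levelOf sP K) M hM) (P.sortR.toPGen cellP c)) := by
  set lv := levelOf sP K with hlv_def
  have hlv : LevelFn K lv := levelFn_levelOf (fun t _ => hs t) (hdrop K)
  have hL0 : 0 < L := by omega
  set g := P.toPGen cellP c with hg
  set h := P.sortR.toPGen cellP c with hh
  set V : PEv → Pt d × Finset (Pt d) → TCell d (n * L ^ K) × Template d M := valP n L K hN lv M hM with hV
  have htwin : h.toGen = P.sortR.gen c := P.toGen_toPGen_sortR cellP hS c
  have hpb : h.pbirths = g.pbirths := P.pbirths_toPGen_sortR cellP hH hS c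
  have hD' : ∀ a ∈ baddr h.toGen, a.length ≤ D := by rw [htwin]; exact hD
  -- the zone-skeleton realised member's letters: birth steps, facts, chronology and dating of the twin's flat tree
  have hsteps : ∀ bz ∈ g.pbirths, lv bz.1.step ≤ K := fun bz hbz =>
    hlv.le_K _ ((step_le_lastStep_of_realisesZ g Z hR bz hbz).trans hKg)
  have hfacts : ∀ bz ∈ g.pbirths,
      bz.2.1 ∈ bz.2.2 ∧ FaceConnected bz.2.2 ∧ treeLen bz.2.2 ≤ (bz.1.fat : ℝ) ∧ tcap d bz.1.fat ≤ M :=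
    fun bz hbz => by
      obtain ⟨h1, h2, h3⟩ := facts_of_realisesZ hR hbz
      exact ⟨h1, h2, h3, hMf bz hbz⟩
  have hchr : Chrono PEv.step h.toGen := by
    rw [htwin]; exact HistoryZoneMassTotalFlat.chronoZ_gen (P := P.sortR) (headOldest_sortR P hH) c
  have hdat : Dated PEv.step true (P.step c + 1) h.toGen := by
    rw [htwin]
    exact HistoryZoneMassTotalFlat.dated_gen (P := P.sortR) (headOldest_sortR P hH) c (Nat.lt_succ_self _)
  -- the cluster predicate, transported from the zone-skeleton realised member to the twin (file J1)
  have hCC : PGen.ClusterConn (fun t m =>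
      regZoneD Prod.fst n L K lv 32 (regR Prod.fst Prod.snd n L K lv) t (toGenL m)) h :=
    P.clusterConn_toPGen_sortR cellP _ hH hS (fun t m m' hmm' => by
      unfold regZoneD coreZoneD; rw [births_toGenL, births_toGenL, hmm']) c
      (clusterConn_of_realisesZ' hL hn hs hdrop hR hKg)
  -- join by join
  rw [← htwin]
  refine (PGen.allJoins_placed_iff c₀ V (PhysTop c₀ PEv.step (zoneP n L K lv 32 c₀)) h hD').2 fun q hq => ?_
  obtain ⟨A, B, s, hcore, hsub, hpbk, hbad, hpl⟩ := exists_core_of_mem_crootsP c₀ V h none q hq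
  rw [hpl]
  have hq2 : q.2 = Gen.merge A.toGen B.toGen ((s, 2, 0) : PEv) := by rw [← hcore]; rfl
  rw [hq2]
  set k := PGen.join A B s with hk
  have hDk : ∀ b ∈ baddr k.toGen, b.length ≤ D := fun b hb => by
    have := hD' _ (hbad b hb); rw [List.length_append] at this; omega
  have hpbk' : k.pbirths ≤ g.pbirths := hpb ▸ hpbk
  -- the join step is at most `K`
  have hsK : lv s ≤ K := by
    have hsub' : Sub (Gen.merge A.toGen B.toGen ((s, 2, 0) : PEv)) h.toGen := by
      rw [← hq2]; exact sub_of_mem_crootsP PEv.step none h.toGen q hq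
    have h1 := (step_le_of_dated_sub hdat hsub').2 rfl
    exact hlv.le_K _ (by simp only [PEv.step_mk] at h1; omega)
  refine physTop_of_tconn PEv.step A.toGen B.toGen ((s, 2, 0) : PEv) c₀ (zoneP n L K lv 32 c₀) ?_ ?_
  · -- clause 1: the part sub-members' zones at the join step are touch-connected
    have hC := hCC q hq
    rw [hq2] at hC
    -- every part: its sub-member, its zone, non-empty
    have hpart : ∀ p ∈ jparts PEv.step (Gen.merge A.toGen B.toGen ((s, 2, 0) : PEv)),
        zoneP n L K lv 32 c₀ s p.2 (rel c₀ p.1 (PGen.placed (D := D) c₀ V k)) =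
          regZoneD Prod.fst n L K lv 32 (regR Prod.fst Prod.snd n L K lv) s (toGenL (PGen.subAt h (q.1 ++ p.1))) ∧
        (regZoneD Prod.fst n L K lv 32 (regR Prod.fst Prod.snd n L K lv) s
          (toGenL (PGen.subAt h (q.1 ++ p.1)))).Nonempty := by
      intro p hp
      have hpk : p ∈ jparts PEv.step k.toGen := hp
      obtain ⟨hna, htoGen⟩ := PGen.subAt_of_mem_jparts hpk
      have hne : p.1 ≠ [] := PGen.fst_ne_nil_of_mem_jparts PEv.step hp
      have hsa : PGen.subAt h (q.1 ++ p.1) = PGen.subAt k p.1 := hsub p.1 hne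
      set k' := PGen.subAt k p.1 with hk'
      have hpbk'' : k'.pbirths ≤ g.pbirths := (PGen.pbirths_subAt_le hna).trans hpbk'
      have hDk' : ∀ b ∈ baddr k'.toGen, b.length ≤ D := fun b hb => by
        have := PGen.depth_subAt hna hDk b hb; omega
      have hz : zoneP n L K lv 32 c₀ s p.2 (rel c₀ p.1 (PGen.placed (D := D) c₀ V k)) =
          regZoneD Prod.fst n L K lv 32 (regR Prod.fst Prod.snd n L K lv) s (toGenL k') := by
        rw [PGen.rel_placed_subAt c₀ V hna hDk, ← htoGen]
        exact zoneP_placed (c := 32) (c₀ := c₀) hL0 hDk' (fun bz hbz => hsteps bz (Multiset.mem_of_le hpbk'' hbz))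
          (fun bz hbz => hfacts bz (Multiset.mem_of_le hpbk'' hbz)) hsK
      refine ⟨by rw [hsa]; exact hz, ?_⟩
      rw [hsa]
      -- non-empty: any birth of the part is a birth of its flat tree `p.2`, dated `≤ s` by chronology
      obtain ⟨bz, hbz, -⟩ := exists_root_pbirth k'
      refine nonempty_regZoneD_toGenL n L K lv 32 hn hL0 hlv ⟨bz, hbz, ?_, ⟨_, (hfacts bz (Multiset.mem_of_le hpbk'' hbz)).1⟩⟩
      have hsubp : Sub p.2 h.toGen :=
        Sub.trans (sub_of_mem_clusterParts PEv.step _ _ p hp)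
          (by rw [← hq2]; exact sub_of_mem_crootsP PEv.step none h.toGen q hq)
      have hchrp : Chrono PEv.step p.2 := chrono_of_sub PEv.step hsubp hchr
      have hft : ftime PEv.step p.2 ≤ s := by
        have h1 := ftime_le_of_sub PEv.step (sub_of_mem_clusterParts PEv.step _ _ p hp)
          (chrono_of_sub PEv.step (by rw [← hq2]; exact sub_of_mem_crootsP PEv.step none h.toGen q hq) hchr)
        exact h1
      have hb : bz.1 ∈ births p.2 := by rw [← htoGen]; exact fst_mem_births_toGen k' hbz
      exact (step_le_ftime_of_chrono hchrp bz.1 hb).trans hft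
    have hT := tconn_of_tconn_map
      (T' := fun A B : Finset (Fin d → ℕ) => (A ∩ B).Nonempty)
      (fun p : List Bool × Gen PEv =>
        regZoneD Prod.fst n L K lv 32 (regR Prod.fst Prod.snd n L K lv) s (toGenL (PGen.subAt h (q.1 ++ p.1))))
      (fun p hp => by rw [inter_self]; exact (hpart p hp).2) hC
    refine TConn.mono (fun p hp p' hp' hpp' => ?_) hT
    have e1 := (hpart p hp).1
    have e2 := (hpart p' hp').1
    simp only [PEv.step_mk]
    rw [e1, e2]
    exact hpp'
  · -- clause 2: distinct parts read different births, from `hdis`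
    intro i j _ hij
    have hdisk : (k.pbirths.map fun bz => (bz.1, V bz.1 bz.2)).Nodup :=
      Multiset.nodup_of_le (Multiset.map_le_map hpbk') hdis
    exact PGen.bread_cfg_placed_ne_of_nodup c₀ V A B s hDk hdisk hij

/-! ## §3 The counted placement reading the member's physical births (zone-skeleton reading) -/

/-- **ROW S6g′ INSTANCE, T3b, OVER THE ZONE SKELETON — A ZONE-SKELETON REALISED MEMBER's PHYSICAL BIRTHS ARE THE
BIRTHS' READING OF A COUNTED PLACEMENT OF ITS SORTED TWIN.**  Under H3's reading conventions (`HeadOldest`,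
`RenewDated`), the member realised in the zone-skeleton sense (`RealisesZ`) with last step `≤ K`, the type bound on its
fatness classes, the depth of the space, an injective root read-out `ρ`, and the displayed side condition `hdis`
(R-OWNER-23-6): SOME `P′ ∈ S (zoneP n L K (levelOf s K) 32 c₀) ρ c₀ PEv.step (P.sortR.gen c) (valP (root label) (root
cell))` has `bread c₀ (P.sortR.gen c) P′ = (pbirths (P.toPGen cellP c)).map (label, valP label payload)`. [folklore] -/
theorem exists_mem_S_sortRZ (hρ : Function.Injective ρ) (hH : ∀ c, P.HeadOldest c) (hS : P.RenewDated) (c : α)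
    {Z : Finset (Pt d)} (hR : RealisesZ L sP (P.toPGen cellP c) Z) (hKg : (P.toPGen cellP c).lastStep ≤ K)
    (hKc : P.step c ≤ K) (hD : ∀ a ∈ baddr (P.sortR.gen c), a.length ≤ D)
    (hMf : ∀ bz ∈ (P.toPGen cellP c).pbirths, tcap d bz.1.fat ≤ M)
    (hdis : ((P.toPGen cellP c).pbirths.map fun bz => (bz.1, valP n L K hN (levelOf sP K) M hM bz.1 bz.2)).Nodup) :
    ∃ P' : Addr D → TCell d (n * L ^ K) × Template d M,
      bread c₀ (P.sortR.gen c) P' =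
          (P.toPGen cellP c).pbirths.map (fun bz => (bz.1, valP n L K hN (levelOf sP K) M hM bz.1 bz.2)) ∧
        P' ∈ S (zoneP n L K (levelOf sP K) 32 c₀) ρ c₀ PEv.step (P.sortR.gen c)
          (valP n L K hN (levelOf sP K) M hM (Gen.root (P.sortR.gen c)) (P.toPGen cellP c).rootCell) := by
  obtain ⟨P', hb, hm⟩ := exists_rearranged_mem_S_zoneP (c := 32) (c₀ := c₀) hρ PEv.step hD
    (P.junk_placed_sortR cellP c₀ _ hS c)
    (allJoins_physTop_sortRZ P cellP hN hM c₀ hL hn hs hdrop hH hS c hR hKg hKc hD hMf hdis)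
  refine ⟨P', ?_, ?_⟩
  · rw [hb, P.bread_placed_sortR cellP c₀ _ hH hS c hD]
  · rwa [P.evalA_placed_sortR_rootAddr cellP c₀ _ hH hS c hD] at hm

end MemberZ

/-! ## §4 Sanity: the landed statement and its print-exact twin through the bridges -/

section SanityJ2

variable {α π : Type*} [DecidableEq α] [DecidableEq π] {d n L K D M : ℕ} (P : Pedigree α π)
  (cellP : π → Pt d × Finset (Pt d)) (hN : 0 < n * L ^ K) (hM : 1 ≤ M) (c₀ : TCell d (n * L ^ K) × Template d M)
  {R' : Type*} [LinearOrder R'] (ρ : (Addr D → TCell d (n * L ^ K) × Template d M) → R')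
  (hL : 3 ≤ L) (hn : 0 < n) {sP : ℕ → ℕ} (hs : ∀ t, sP (t + 1) ≤ sP t) (hdrop : ∀ m, DropCtl sP m) {Rw : ℕ → ℕ}

/-- the LANDED `exists_mem_S_sortR` (row S1b's frozen reading) is the corollary through bridge 1 [folklore] -/
example (hρ : Function.Injective ρ) (hH : ∀ c, P.HeadOldest c) (hS : P.RenewDated) (c : α)
    {Z : Finset (Pt d)} (hR : Realises L sP Rw (P.toPGen cellP c) Z) (hKg : (P.toPGen cellP c).lastStep ≤ K)
    (hKc : P.step c ≤ K) (hD : ∀ a ∈ baddr (P.sortR.gen c), a.length ≤ D)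
    (hMf : ∀ bz ∈ (P.toPGen cellP c).pbirths, tcap d bz.1.fat ≤ M)
    (hdis : ((P.toPGen cellP c).pbirths.map fun bz => (bz.1, valP n L K hN (levelOf sP K) M hM bz.1 bz.2)).Nodup) :
    ∃ P' : Addr D → TCell d (n * L ^ K) × Template d M,
      bread c₀ (P.sortR.gen c) P' =
          (P.toPGen cellP c).pbirths.map (fun bz => (bz.1, valP n L K hN (levelOf sP K) M hM bz.1 bz.2)) ∧
        P' ∈ S (zoneP n L K (levelOf sP K) 32 c₀) ρ c₀ PEv.step (P.sortR.gen c)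
          (valP n L K hN (levelOf sP K) M hM (Gen.root (P.sortR.gen c)) (P.toPGen cellP c).rootCell) :=
  exists_mem_S_sortRZ P cellP hN hM c₀ ρ hL hn hs hdrop hρ hH hS c (realisesZ_of_realises _ Z hR) hKg hKc hD hMf hdis

/-- the owner's PRINT-EXACT reading `RealisesP` (R-40-a) gives the same, through bridge 2 [folklore] -/
example (hρ : Function.Injective ρ) (hH : ∀ c, P.HeadOldest c) (hS : P.RenewDated) (c : α)
    {Z : Finset (Pt d)} (hR : HistoryRealisePrint.RealisesP L sP Rw (P.toPGen cellP c) Z)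
    (hKg : (P.toPGen cellP c).lastStep ≤ K) (hKc : P.step c ≤ K) (hD : ∀ a ∈ baddr (P.sortR.gen c), a.length ≤ D)
    (hMf : ∀ bz ∈ (P.toPGen cellP c).pbirths, tcap d bz.1.fat ≤ M)
    (hdis : ((P.toPGen cellP c).pbirths.map fun bz => (bz.1, valP n L K hN (levelOf sP K) M hM bz.1 bz.2)).Nodup) :
    ∃ P' : Addr D → TCell d (n * L ^ K) × Template d M,
      bread c₀ (P.sortR.gen c) P' =
          (P.toPGen cellP c).pbirths.map (fun bz => (bz.1, valP n L K hN (levelOf sP K) M hM bz.1 bz.2)) ∧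
        P' ∈ S (zoneP n L K (levelOf sP K) 32 c₀) ρ c₀ PEv.step (P.sortR.gen c)
          (valP n L K hN (levelOf sP K) M hM (Gen.root (P.sortR.gen c)) (P.toPGen cellP c).rootCell) :=
  exists_mem_S_sortRZ P cellP hN hM c₀ ρ hL hn hs hdrop hρ hH hS c (realisesZ_of_realisesP _ Z hR) hKg hKc hD hMf hdis

end SanityJ2

end

end Summit.QuantumFields.BalabanUV.T4Continuum.HistoryJoinsPlacedMember
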